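import Summits.QuantumFields.YangMills.Theorems.FluctuationComparisonRegPrIntLS2BetaCurlBudgetDischarged
import Summits.QuantumFields.YangMills.Theorems.FluctuationComparisonRegPrIntLS2BetaJunctionEnergyShare
import HarnessLib

/-!
# S2β · (SCT″-c)₁ — «THE c₁ LETTER WITH THE JUNCTION ON THE PURSE»: ✓p840402 `c1Budget_discharged` ∘ ✓(JNC-E)′ `junctionRow_le_purse_of_supDecay` (px21 g26) — the
# collapsed junction term `L^{K−J−2}·Σ junction₀(X)²` replaced by the K-uniform PURSE-share `(768·c²·L)·purse` under ONE displayed letter `hζc : ‖ζ ℓ‖ ≤ c·(L⁻¹)^{K−J}`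
# ((SUP-DECAY)₀ at the Thm-2 representative): after this file the c₁ letter's `W·Bsrc` bracket carries ONLY S′-shares (linear, R) and a purse-share (junction):
# `Σ_{t<K−J} L^t·c₁(t) ≤ 2·(2·Cst·C₅)·(4·L⁻¹·(L^{K−J}·REL) + 7·(12d²Γ²(2(C_B+1)α)²·S′∕L + 192·d²·A²·S′∕L + 3·((768·c²·L)·purse))) + 2·(256·Cst·Mbar²·C_cov)·S′`,
# `purse := (L⁻¹)^{K−J}·Σ_ℓ‖ζ ℓ‖² + L^{K−J}·REL`.

Cell `ym3-torus` (YM ladder rung R3 = continuum `SU(2)` Yang–Mills on the three-torus at fixed lattice data — a RUNG: NOT d = 4, NOT infinite volume, NOT a mass gap,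
NOT Clay).  Width seat `ym-ust-20520-w4` (gen 29); crux `stmt-QuantumFields-20520`, LINE g18-1 S2β; piece (e′) (announced 2026-09-01T03:00:24Z; px21 g26's DOCK twin
`DOCK-w4-JunctionRow` rc 0 both ways).  `--kind proof --supports stmt-QuantumFields-20520 --as helper`, count-neutral, DEFINITION-FREE (0 `def`, 0 `instance`, 0 `notation`,
0 `sorry`, default heartbeats).

WHAT IS PROVED (sorry-free; composition BY NAME).  ★★★`c1Budget_discharged_supDecay`: hypotheses = ✓p840402's (`hJK Cst hCst U₀ ζ X hXdef Mg hMg hMg4 C_B α hCB hα hBKG h24 hSU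
R hR0 hR a A hRa ha`) ⊕ ✓(JNC-E)′'s `(c : ℝ) (hc0 : 0 ≤ c) (hc4 : 4·c ≤ 1) (hζc : ∀ ℓ, ‖ζ ℓ‖ ≤ c·(L⁻¹)^(K−J))` ⊕ `Mbar hM0 hM1 hM`; conclusion = ✓p840402's with the
junction term `3·(L^(K−J−2)·Σ junction₀(X)²)` ↦ `3·((768·c²·L)·purse)`. Proof = ✓p840402's, the junction branch being `junctionRow_le_of_weightOne … |>.trans
(junctionRow_le_purse_of_supDecay …)`.

DOMAIN LINE (plan (3) v4; architect px17 g23 «WEIGHT LINE» v2 01:53:02Z∕02:25:49Z, (S1)∕(S2) 02:00:25Z; desk №130∕№718∕№720).  `hζc` IS (REG)@representative's sup letter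
at the finest level ([Balaban1985RegularSpaces] Thm 2 (1.36): `ζ = ηA`, `‖ζ‖ ≤ c·η`, `η = L^{−(K−J)}`) — the same `hrep` that the R-row's `O·M`∕`O²` pieces ride
((O3-R) px20 g25 `…RemainderRowClass` ⧗, (O3-a) px12∕px13); so after (e′) the c₁ letter is: (T) windows ⟸ ✓p836413; (BKG); `hRa`∕`ha` ⟸ (O3-R)∕(O3-a); `hζc` ⟸ (REG)@rep
∘ (RES-u); `B8Thm2AtT3Members` a theorem for `L ≥ 5`, `hThm2S3` at `L = 3`. [Balaban1985Averaging] (19)–(20) p.21, Prop. 3 (123), Prop. 4 (128)–(135) pp.37–38;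
[Balaban1987RG1] (0.1)–(0.4), (0.11), (0.18) pp.251–255.

HONEST SCOPE.  Composition of landed letters; nothing of Bałaban's renormalisation-group analysis is asserted or proved; (BKG), (T), `R`∕`hRa`∕`ha`, `hζc`, `REL`, `S′` are
HYPOTHESES or others'; GAP♯∘ (`stub_uniformFibreGapOrbit`, registry 3732b7df UNTOUCHED, 0∕5), S2β, the five registered stubs, crux 20520, 19936, 19200 and `YM3TorusSU2`
are NOT proved; no registered stub is closed; rung R3 — NOT d = 4, NOT infinite volume, NOT a mass gap, NOT Clay; the Yang–Mills mass gap is NOT proved.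
-/

set_option autoImplicit false

noncomputable section

open scoped Matrix.Norms.L2Operator
open Finset

namespace Summit.QuantumFields.YangMills.Theorems.FluctuationComparisonRegPrIntLS2BetaCurlBudgetDischargedPurseJunction

open Literature.MathematicalPhysics.QuantumFieldTheory.Balaban1983to89
open Literature.MathematicalPhysics.QuantumFieldTheory.Balaban1983to89.T4Continuum
open Literature.MathematicalPhysics.QuantumFieldTheory.Balaban1983to89.T3ContinuumYM3Torus
open Literature.MathematicalPhysics.QuantumFieldTheory.Balaban1983to89.T3LevelShift
open Literature.MathematicalPhysics.QuantumFieldTheory.Balaban1983to89.T3TiltDescent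
open Literature.MathematicalPhysics.QuantumFieldTheory.Balaban1983to89.T3UnitLawDensityEML (ℰp)
open Literature.MathematicalPhysics.QuantumFieldTheory.Balaban1983to89.T4HaarSU2ExpChart (expPoint)
open Literature.MathematicalPhysics.QuantumFieldTheory.Balaban1983to89.T4ExpWindowSmallField (logVec)
open Literature.MathematicalPhysics.QuantumFieldTheory.Balaban1983to89.HaarExponentialChart
open Literature.MathematicalPhysics.QuantumFieldTheory.Balaban1983to89.HaarExponentialChart.IsChartRep
open Literature.MathematicalPhysics.QuantumFieldTheory.Balaban1983to89.BlockAveraging (Idx blockAvg avgFun loopHol)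
open Literature.MathematicalPhysics.QuantumFieldTheory.Balaban1983to89.ExpMeanLog (expMeanLogSU deltaSU)
open Literature.MathematicalPhysics.QuantumFieldTheory.Balaban1983to89.BlockAveragingEMLLinearisedBackground (covWalkSum)
open Literature.MathematicalPhysics.QuantumFieldTheory.Balaban1983to89.B10Eq47AxialChi (shiftN)
open Literature.MathematicalPhysics.QuantumFieldTheory.Balaban1983to89.B14.Eq22Determines (blockIter)
open Literature.MathematicalPhysics.QuantumFieldTheory.Balaban1983to89.B10Eq27TorusAxialLog (rel)
open Literature.MathematicalPhysics.QuantumFieldTheory.Balaban1983to89.B10Eq18SigmaSU2 (su2Coord)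
open Literature.MathematicalPhysics.QuantumFieldTheory.Balaban1983to89.B10Eq18SigmaSU2Haar (rev)
open Literature.MathematicalPhysics.QuantumLattice (su2Quat)
open Summit.QuantumFields.YangMills.Theorems.FluctuationComparisonRegPrIntLS2BetaChartReadDescentOntoExpPoint (su2Coord_rev_mem_lie)
open Summit.QuantumFields.YangMills.Theorems.FluctuationComparisonRegPrIntLS2BetaCurlBudgetLetter (c1Budget_of_letters)
open Summit.QuantumFields.YangMills.Theorems.FluctuationComparisonRegPrIntLS2BetaSourceRowEnergySplit (Bsrc_split_le cornerM_nonneg cornerM_dominates cornerM_energy)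
open Summit.QuantumFields.YangMills.Theorems.FluctuationComparisonRegPrIntLS2BetaSourceClassesOfBkg (exists_srcClasses_of_bkg')
open Summit.QuantumFields.YangMills.Theorems.FluctuationComparisonRegPrIntLS2BetaSourceEnergyLinearShareOfVol (Elin_le_beta_Sprime)
open Summit.QuantumFields.YangMills.Theorems.FluctuationComparisonRegPrIntLS2BetaRowEnergyShareOfVol (ER_le_beta_Sprime)
open Summit.QuantumFields.YangMills.Theorems.FluctuationComparisonRegPrIntLS2BetaAdmissibleWeights (exists_admissible_weights_v2)
open Summit.QuantumFields.YangMills.Theorems.FluctuationComparisonRegPrIntLS2BetaCurlBudgetDischarged (junctionRow_le_of_weightOne)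
open Summit.QuantumFields.YangMills.Theorems.FluctuationComparisonRegPrIntLS2BetaJunctionEnergyShare (junctionRow_le_purse_of_supDecay)

variable (F : T3Family)

/-- ★★★ **THE c₁ LETTER WITH THE JUNCTION ON THE PURSE** — ✓`c1Budget_discharged`'s construction with the junction row bounded by ✓`junctionRow_le_purse_of_supDecay`
under `hζc`; see the module header. [cite: Balaban1985RegularSpaces, Thm 2 (1.36) p.83; Balaban1985Averaging, Prop. 4 (128)-(135) pp.37-38; Balaban1987RG1, (0.11), (0.18) pp.253-255] -/
theorem c1Budget_discharged_supDecay {J K : ℕ} (hJK : J ≤ K) (Cst : ℝ) (hCst : 0 ≤ Cst)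
    (U₀ : GaugeField (F.P K) 0 (Matrix.specialUnitaryGroup (Fin 2) ℂ)) (ζ : PBond (F.P K) 0 → EuclideanSpace ℝ (Fin 3))
    (X : (i : ℕ) → PBond (F.P K) i → (specialUnitaryLogChart (Fin 2)).lie)
    (hXdef : X = fun (i : ℕ) (b : PBond (F.P K) i) =>
      (⟨su2Coord (rev (logVec (su2Quat (Averaging.iter (fun k => BlockAveraging.blockAvg (P := F.P K) (j := k) ℰp) i (fun ℓ => expPoint (ζ ℓ) * U₀ ℓ : GaugeField (F.P K) 0 (Matrix.specialUnitaryGroup (Fin 2) ℂ)) b * (Averaging.iter (fun k => BlockAveraging.blockAvg (P := F.P K) (j := k) ℰp) i U₀ b)⁻¹)))), su2Coord_rev_mem_lie _⟩ : (specialUnitaryLogChart (Fin 2)).lie))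
    (Mg : ℕ → ℝ) (hMg : ∀ t, t ≤ K - J → ∀ b : PBond (F.P K) t,
      ‖logVec (su2Quat (Averaging.iter (fun k => BlockAveraging.blockAvg (P := F.P K) (j := k) ℰp) t (fun ℓ => expPoint (ζ ℓ) * U₀ ℓ : GaugeField (F.P K) 0 (Matrix.specialUnitaryGroup (Fin 2) ℂ)) b * (Averaging.iter (fun k => BlockAveraging.blockAvg (P := F.P K) (j := k) ℰp) t U₀ b)⁻¹))‖ ≤ Mg t)
    (hMg4 : ∀ t, t ≤ K - J → Mg t ≤ 1 / 4)
    (C_B α : ℝ) (hCB : 0 ≤ C_B) (hα : 0 < α)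
    (hBKG : ∀ t, t ≤ K - J → ∀ p : Plaq (F.P K) t,
      dist1 (GaugeField.plaqHol (Averaging.iter (fun k => BlockAveraging.blockAvg (P := F.P K) (j := k) ℰp) t U₀) p) ≤
        C_B * α * (F.L : ℝ) ^ (2 * t) * ((F.L : ℝ)⁻¹) ^ (2 * (K - J)))
    (h24 : ((((F.P K).d + 2) * (F.P K).L : ℕ) : ℝ) ^ 2 / 4 * ((C_B + 1) * α) ≤ 1 / 24)
    (hSU : ((((F.P K).d + 2) * (F.P K).L : ℕ) : ℝ) ^ 2 / 4 * ((C_B + 1) * α) < deltaSU (Fin 2))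
    (R : Fin (F.P K).d → Fin (F.P K).d → (i : ℕ) → Site (F.P K) i → ℝ) (hR0 : ∀ μ ν i x, 0 ≤ R μ ν i x)
    (hR : ∀ μ ν : Fin (F.P K).d, μ < ν → ∀ i, i < K - J → ∀ (y' : Site (F.P K) (i + 1)) (c : PBond (F.P K) (i + 1)),
      (c = ⟨y', μ⟩ ∨ c = ⟨y'.shift μ, ν⟩ ∨ c = ⟨y'.shift ν, μ⟩ ∨ c = ⟨y', ν⟩) →
      ‖(((isChartRep_specialUnitaryGroup (n := Fin 2)).logChart (avgFun (expMeanLogSU (n := Fin 2)) (fun b => (isChartRep_specialUnitaryGroup (n := Fin 2)).expChart (X i b) * Averaging.iter (fun k => BlockAveraging.blockAvg (P := F.P K) (j := k) ℰp) i U₀ b) c * (avgFun (expMeanLogSU (n := Fin 2)) (Averaging.iter (fun k => BlockAveraging.blockAvg (P := F.P K) (j := k) ℰp) i U₀) c)⁻¹) : (specialUnitaryLogChart (Fin 2)).lie) : Matrix (Fin 2) (Fin 2) ℂ) -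
        ((fderiv ℝ (fun (A : PBond (F.P K) i → (specialUnitaryLogChart (Fin 2)).lie) (c : PBond (F.P K) (i + 1)) => (isChartRep_specialUnitaryGroup (n := Fin 2)).logChart (avgFun (expMeanLogSU (n := Fin 2)) (fun b => (isChartRep_specialUnitaryGroup (n := Fin 2)).expChart (A b) * Averaging.iter (fun k => BlockAveraging.blockAvg (P := F.P K) (j := k) ℰp) i U₀ b) c * (avgFun (expMeanLogSU (n := Fin 2)) (Averaging.iter (fun k => BlockAveraging.blockAvg (P := F.P K) (j := k) ℰp) i U₀) c)⁻¹)) 0 (X i) c : (specialUnitaryLogChart (Fin 2)).lie) : Matrix (Fin 2) (Fin 2) ℂ)‖ ≤ R μ ν (i + 1) y')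
    (a : ℕ → ℝ) (A : ℝ)
    (hRa : ∀ (μ ν : Fin (F.P K).d) (i : ℕ), i < K - J → ∀ y' : Site (F.P K) (i + 1),
      R μ ν (i + 1) y' ^ 2 ≤ a (i + 1) ^ 2 * ∑ b ∈ univ.filter (fun b : PBond (F.P K) i =>
        blockOf b.src = y' ∨ blockOf b.src = y'.shift μ ∨ blockOf b.src = y'.shift ν ∨ blockOf b.src = (y'.shift μ).shift ν), ‖X i b‖ ^ 2)
    (ha : ∀ i, i < K - J → a (i + 1) ^ 2 ≤ A ^ 2 * ((F.L : ℝ) ^ (2 * i) / (F.L : ℝ) ^ (2 * (K - J))) ^ 2)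
    (c : ℝ) (hc0 : 0 ≤ c) (hc4 : 4 * c ≤ 1)
    (hζc : ∀ ℓ : PBond (F.P K) 0, ‖ζ ℓ‖ ≤ c * ((F.L : ℝ)⁻¹) ^ (K - J))
    (Mbar : ℝ) (hM0 : 0 ≤ Mbar) (hM1 : 4 * Mbar ≤ 1)
    (hM : ∀ s, s < K - J → ∀ b : PBond (F.P K) s, ‖logVec (su2Quat (Averaging.iter (fun k => BlockAveraging.blockAvg (P := F.P K) (j := k) ℰp) s (fun ℓ => expPoint (ζ ℓ) * U₀ ℓ : GaugeField (F.P K) 0 (Matrix.specialUnitaryGroup (Fin 2) ℂ)) b * (Averaging.iter (fun k => BlockAveraging.blockAvg (P := F.P K) (j := k) ℰp) s U₀ b)⁻¹))‖ ≤ Mbar) :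
    ∑ t ∈ Finset.range (K - J), (F.L : ℝ) ^ t * (fun t => Cst * ∑ B : PBond (F.P J) 0,
      ‖(fun p : Plaq (F.P K) (K - J - 1 - t) =>
        if ∃ z₀ : Site (F.P K) 0, (blockIter (K - J) z₀ = (bondShift (F.sitesPerDir_eq (m := F.m) (K := J) (j := 0) (m' := F.m) (K' := K) (j' := K - J) (by omega)) B).src ∨
            blockIter (K - J) z₀ = (bondShift (F.sitesPerDir_eq (m := F.m) (K := J) (j := 0) (m' := F.m) (K' := K) (j' := K - J) (by omega)) B).tgt) ∧
            ∀ κ, (rel (blockIter (K - J - 1 - t) z₀) p.src κ).natAbs ≤ (2 * F.L + 1)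
        then dist1 ((GaugeField.plaqHol (Averaging.iter (fun k => BlockAveraging.blockAvg (P := F.P K) (j := k) ℰp) (K - J - 1 - t) U₀) p)⁻¹ *
          GaugeField.plaqHol (Averaging.iter (fun k => BlockAveraging.blockAvg (P := F.P K) (j := k) ℰp) (K - J - 1 - t)
            (fun ℓ => expPoint (ζ ℓ) * U₀ ℓ : GaugeField (F.P K) 0 (Matrix.specialUnitaryGroup (Fin 2) ℂ))) p)
        else 0)‖ ^ 2) t ≤
      2 * ((2 * Cst * (((5 ^ (F.P K).d : ℕ) : ℝ) ^ 2 * (((2 * ((2 * F.L + 1) + 2) + 1) ^ (F.P K).d * 6 : ℕ) : ℝ) *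
              (2 * ((((F.P K).L ^ (F.P K).d : ℕ) : ℝ) - 1) / ((((F.P K).L ^ (F.P K).d : ℕ) : ℝ) - 3)))) * (4 * (F.L : ℝ)⁻¹ * ((F.L : ℝ) ^ (K - J) * ∑ p : Plaq (F.P K) 0,
                  (1 - reTr ((GaugeField.plaqHol U₀ p)⁻¹ * GaugeField.plaqHol (fun ℓ => expPoint (ζ ℓ) * U₀ ℓ : GaugeField (F.P K) 0 (Matrix.specialUnitaryGroup (Fin 2) ℂ)) p))) + 7 *
      (12 * ((F.P K).d : ℝ) ^ 2 * (2 * ((F.P K).L : ℝ) ^ 2 * (3 * (F.P K).L + 2) + 2 * ((F.P K).L : ℝ) ^ 2 + (48 * (F.P K).L + 24 * ((((F.P K).d + 2) * (F.P K).L : ℕ) : ℝ) + 1616 * ((((F.P K).d + 2) * (F.P K).L : ℕ) : ℝ)) * (((((F.P K).d + 2) * (F.P K).L : ℕ) : ℝ) ^ 2 / 4) +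
        2 * ((((F.P K).d + 2) * (F.P K).L : ℕ) : ℝ) * ((F.L : ℝ) ^ 2)) ^ 2 * (2 * ((C_B + 1) * α)) ^ 2 *
        (∑ t ∈ Finset.range (K - J), (if ht : t < K - J then
          (F.L : ℝ) ^ t * ∑ B : PBond (F.P J) 0,
            ‖(fun ℓ' : PBond (F.P (J + (t + 1))) 0 =>
              if ∃ z : Site (F.P (J + (t + 1))) 0,
                (B14.Eq22Determines.blockIter (t + 1) z = (bondShift (F.sitesPerDir_eq (m := F.m) (K := J) (j := 0) (m' := F.m) (K' := J + (t + 1)) (j' := t + 1) (by omega)) B).src ∨ B14.Eq22Determines.blockIter (t + 1) z = (bondShift (F.sitesPerDir_eq (m := F.m) (K := J) (j := 0) (m' := F.m) (K' := J + (t + 1)) (j' := t + 1) (by omega)) B).tgt) ∧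
                ∀ ν, (B10Eq27TorusAxialLog.rel z ℓ'.src ν).natAbs ≤ 2
              then logVec (su2Quat (descendTo F ℰp (J + (t + 1)) K (by omega) (fun ℓ => expPoint (ζ ℓ) * U₀ ℓ : GaugeField (F.P K) 0 (Matrix.specialUnitaryGroup (Fin 2) ℂ)) ℓ' * (descendTo F ℰp (J + (t + 1)) K (by omega) U₀ ℓ')⁻¹)) else 0)‖ ^ 2
        else 0)) / (F.L : ℝ) +
      (192 * ((F.P K).d : ℝ) ^ 2 * A ^ 2 *
        (∑ t ∈ Finset.range (K - J), (if ht : t < K - J then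
          (F.L : ℝ) ^ t * ∑ B : PBond (F.P J) 0,
            ‖(fun ℓ' : PBond (F.P (J + (t + 1))) 0 =>
              if ∃ z : Site (F.P (J + (t + 1))) 0,
                (B14.Eq22Determines.blockIter (t + 1) z = (bondShift (F.sitesPerDir_eq (m := F.m) (K := J) (j := 0) (m' := F.m) (K' := J + (t + 1)) (j' := t + 1) (by omega)) B).src ∨ B14.Eq22Determines.blockIter (t + 1) z = (bondShift (F.sitesPerDir_eq (m := F.m) (K := J) (j := 0) (m' := F.m) (K' := J + (t + 1)) (j' := t + 1) (by omega)) B).tgt) ∧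
                ∀ ν, (B10Eq27TorusAxialLog.rel z ℓ'.src ν).natAbs ≤ 2
              then logVec (su2Quat (descendTo F ℰp (J + (t + 1)) K (by omega) (fun ℓ => expPoint (ζ ℓ) * U₀ ℓ : GaugeField (F.P K) 0 (Matrix.specialUnitaryGroup (Fin 2) ℂ)) ℓ' * (descendTo F ℰp (J + (t + 1)) K (by omega) U₀ ℓ')⁻¹)) else 0)‖ ^ 2
        else 0)) / (F.L : ℝ)) +
      3 * ((768 * c ^ 2 * (F.L : ℝ)) *
        (((F.L : ℝ)⁻¹) ^ (K - J) * ∑ ℓ : PBond (F.P K) 0, ‖ζ ℓ‖ ^ 2 +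
          (F.L : ℝ) ^ (K - J) * ∑ p : Plaq (F.P K) 0,
            (1 - reTr ((GaugeField.plaqHol U₀ p)⁻¹ * GaugeField.plaqHol (fun ℓ => expPoint (ζ ℓ) * U₀ ℓ : GaugeField (F.P K) 0 (Matrix.specialUnitaryGroup (Fin 2) ℂ)) p))))))) +
      2 * ((256 * Cst * Mbar ^ 2 * ((2 * (F.P J).d * (2 * 3 + 1) ^ (F.P J).d : ℕ) : ℝ)) * (∑ t ∈ Finset.range (K - J), (if ht : t < K - J then
          (F.L : ℝ) ^ t * ∑ B : PBond (F.P J) 0,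
            ‖(fun ℓ' : PBond (F.P (J + (t + 1))) 0 =>
              if ∃ z : Site (F.P (J + (t + 1))) 0,
                (B14.Eq22Determines.blockIter (t + 1) z = (bondShift (F.sitesPerDir_eq (m := F.m) (K := J) (j := 0) (m' := F.m) (K' := J + (t + 1)) (j' := t + 1) (by omega)) B).src ∨ B14.Eq22Determines.blockIter (t + 1) z = (bondShift (F.sitesPerDir_eq (m := F.m) (K := J) (j := 0) (m' := F.m) (K' := J + (t + 1)) (j' := t + 1) (by omega)) B).tgt) ∧
                ∀ ν, (B10Eq27TorusAxialLog.rel z ℓ'.src ν).natAbs ≤ 2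
              then logVec (su2Quat (descendTo F ℰp (J + (t + 1)) K (by omega) (fun ℓ => expPoint (ζ ℓ) * U₀ ℓ : GaugeField (F.P K) 0 (Matrix.specialUnitaryGroup (Fin 2) ℂ)) ℓ' * (descendTo F ℰp (J + (t + 1)) K (by omega) U₀ ℓ')⁻¹)) else 0)‖ ^ 2
        else 0))) := by
  have hL2 : (2 : ℝ) ≤ (F.L : ℝ) := by exact_mod_cast F.hL.2
  have hL1 : (1 : ℝ) ≤ (F.L : ℝ) := by linarith
  have hL0 : (0 : ℝ) ≤ (F.L : ℝ) := by linarith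
  -- the weights: WEIGHT LINE v2 with the summable tail (✓p840245), `W := 7`
  obtain ⟨w, hw, hW, hwdom, hw1, _hwline⟩ := exists_admissible_weights_v2 (L := (F.L : ℝ)) hL2 (K - J)
  -- (BKG) with `C_B + 1` (monotone weakening) so that `0 < (C_B + 1)·α`
  have hCB1 : (0 : ℝ) ≤ C_B + 1 := by linarith
  have hpos : 0 < (C_B + 1) * α := by positivity
  have hBKG' : ∀ t, t ≤ K - J → ∀ p : Plaq (F.P K) t,
      dist1 (GaugeField.plaqHol (Averaging.iter (fun k => BlockAveraging.blockAvg (P := F.P K) (j := k) ℰp) t U₀) p) ≤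
        (C_B + 1) * α * (F.L : ℝ) ^ (2 * t) * ((F.L : ℝ)⁻¹) ^ (2 * (K - J)) := by
    intro t ht p
    refine (hBKG t ht p).trans ?_
    have h0 : 0 ≤ α * (F.L : ℝ) ^ (2 * t) * ((F.L : ℝ)⁻¹) ^ (2 * (K - J)) :=
      mul_nonneg (mul_nonneg hα.le (pow_nonneg hL0 _)) (pow_nonneg (inv_nonneg.2 hL0) _)
    have h1 : C_B * α * (F.L : ℝ) ^ (2 * t) * ((F.L : ℝ)⁻¹) ^ (2 * (K - J)) =
        C_B * (α * (F.L : ℝ) ^ (2 * t) * ((F.L : ℝ)⁻¹) ^ (2 * (K - J))) := by ring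
    have h2 : (C_B + 1) * α * (F.L : ℝ) ^ (2 * t) * ((F.L : ℝ)⁻¹) ^ (2 * (K - J)) =
        (C_B + 1) * (α * (F.L : ℝ) ^ (2 * t) * ((F.L : ℝ)⁻¹) ^ (2 * (K - J))) := by ring
    rw [h1, h2]
    exact mul_le_mul_of_nonneg_right (by linarith) h0
  -- the three classes, at `Cθ := 2·(C_B + 1)·α`
  obtain ⟨αc, δc, αpc, αpbc, h1, h2, h3, h4, h5, h6, h7, h8, h9, h10, h11, hδr, hαr, hαpr⟩ :=
    exists_srcClasses_of_bkg' F U₀ (C_B + 1) α hCB1 hα.le hpos hL1 hBKG' h24 hSU (2 * ((C_B + 1) * α)) le_rfl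
  have hV2 := Elin_le_beta_Sprime F hJK U₀ ζ X hXdef αc δc αpbc (2 * ((C_B + 1) * α))
    (((((F.P K).d + 2) * (F.P K).L : ℕ) : ℝ) ^ 2 / 4) ((F.L : ℝ) ^ 2) hδr hαr hαpr h9 h4 h11
  have hV4 := ER_le_beta_Sprime F hJK U₀ ζ X hXdef R a A hRa ha
  -- the ℓ²-corner size as an opaque size letter `M`
  obtain ⟨M, hM', hXM, hEM⟩ : ∃ M : Fin (F.P K).d → Fin (F.P K).d → (i : ℕ) → Site (F.P K) i → ℝ,
      (∀ μ ν i x, 0 ≤ M μ ν i x) ∧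
      (∀ μ ν : Fin (F.P K).d, μ < ν → ∀ i, i < K - J → ∀ (y' : Site (F.P K) (i + 1)) (b : PBond (F.P K) i),
      (blockOf b.src = y' ∨ blockOf b.src = y'.shift μ ∨ blockOf b.src = y'.shift ν ∨ blockOf b.src = (y'.shift μ).shift ν) → ‖X i b‖ ≤ M μ ν (i + 1) y') ∧
      (∀ i, i < K - J → ∑ μ : Fin (F.P K).d, ∑ ν : Fin (F.P K).d, ∑ y' : Site (F.P K) (i + 1), M μ ν (i + 1) y' ^ 2 ≤ 4 * ((F.P K).d : ℝ) ^ 2 * ∑ b : PBond (F.P K) i, ‖X i b‖ ^ 2) :=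
    ⟨_, cornerM_nonneg F X, cornerM_dominates F X, fun i _ => cornerM_energy F X i⟩
  refine c1Budget_of_letters F hJK Cst hCst U₀ ζ w hw 7 hW X hXdef Mg hMg hMg4 αc δc αpc h1 h2 h3 h4 h5 h6 h7 h8
    M hM' hXM R hR0 hR _ ?_ Mbar hM0 hM1 hM
  refine (Bsrc_split_le F X w hw αc δc αpc αpbc h4 h9 h7 h10 M
    (fun i => 4 * ((F.P K).d : ℝ) ^ 2 * ∑ b : PBond (F.P K) i, ‖X i b‖ ^ 2) hEM R).trans ?_
  refine add_le_add (add_le_add ?_ ?_) ?_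
  · -- linear row: weight monotonicity, then the volume-road share
    refine le_trans ?_ hV2
    refine mul_le_mul_of_nonneg_left (Finset.sum_le_sum fun i hi => ?_) (by norm_num)
    exact mul_le_mul_of_nonneg_right (mul_le_mul_of_nonneg_right (hwdom i (Finset.mem_range.1 hi)) (pow_nonneg hL0 _))
      (mul_nonneg (sq_nonneg _) (mul_nonneg (mul_nonneg (by norm_num) (sq_nonneg _)) (Finset.sum_nonneg fun _ _ => sq_nonneg _)))
  · -- R row: weight monotonicity, then (V4)
    refine le_trans ?_ hV4
    refine mul_le_mul_of_nonneg_left (Finset.sum_le_sum fun i hi => ?_) (by norm_num)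
    exact mul_le_mul_of_nonneg_right (mul_le_mul_of_nonneg_right (hwdom i (Finset.mem_range.1 hi)) (pow_nonneg hL0 _))
      (Finset.sum_nonneg fun _ _ => Finset.sum_nonneg fun _ _ => Finset.sum_nonneg fun _ _ => sq_nonneg _)
  · -- junction row: collapse to `i = 0` (✓`junctionRow_le_of_weightOne`), then the purse-share at a decaying representative (✓px21 `junctionRow_le_purse_of_supDecay`)
    exact mul_le_mul_of_nonneg_left ((junctionRow_le_of_weightOne F X w hw1).trans
      (junctionRow_le_purse_of_supDecay F U₀ ζ X hXdef c hc0 hc4 hζc)) (by norm_num)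

end Summit.QuantumFields.YangMills.Theorems.FluctuationComparisonRegPrIntLS2BetaCurlBudgetDischargedPurseJunction

end
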